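import Summits.ValiantsHypothesis.ValiantsHypothesis.Theorems.AnyonJetsJetConstantElimIntegralMultipleTwoAdicSlices
import Summits.ValiantsHypothesis.ValiantsHypothesis.Theorems.AnyonJetsJetConstantElimIntegralMultipleTwoAdicFormalDegree
import HarnessLib

/-!
# AnyonJets — crux `JetConstantElimTwoAdic` (stmt-ValiantsHypothesis-23655), stub
# `∃ b₁, IntegralMultipleTwoAdicWith b₁`: the stub reduces to the MIXED height normal form

One kernel statement for "the open content of the stub is the height normal form of near-optimal
circuits of the jets with (odd common denominator OR polynomial formal degree)": each near-optimal
`ℚ̄`-circuit `Q` for `J_(n,k)`, `k ≤ log₂ n`, is to be replaced by `Q'` with constants in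
`(1/N) · Σ_l ℤ β_l` (`β ∋ 1` `ℚ`-independent with integer multiplication table, rank `≤ X^a`,
height `≤ X^a`, `size Q' ≤ X^a`, `X = size Q + n + 2`) where EITHER `N` is odd (2-adically
integral constants — the route header's `HeightNormalForm`) OR the formal degree of the skeleton
of `Q'` is `≤ X^a` (dyadic denominators allowed). Both branches are the landed slices
(`…TwoAdicSlices`, `…TwoAdicFormalDegree`); this file only merges them:

* `integralMultipleTwoAdicWith_of_heightNormalFormMixed : HNF₂₃_a → IntegralMultipleTwoAdicWith (5a + 12)`.

Honest framing: a reduction; `HNF₂₃` is conjecture-grade (field of definition of near-optimal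
circuits); the crux and VP ≠ VNP stay open.
-/

noncomputable section

-- single-conjunct layout: Sub = Summit, duplicated namespace component intended
set_option linter.dupNamespace false

namespace Summit.ValiantsHypothesis.ValiantsHypothesis.Theorems.AnyonJets.JetConstantElim

open MvPolynomial Literature.Computability.AlgebraicComplexity
open Literature.Computability.AlgebraicComplexity.ArithCircuit
open Summit.ValiantsHypothesis.ValiantsHypothesis.Theorems.AnyonJets.ConstantFreeJetGrowth (jet)
open scoped BigOperators

/-- **`HNF₂₃_a → IntegralMultipleTwoAdicWith (5a + 12)`** (mixed height normal form: per circuit,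
odd common denominator OR bounded formal degree of the skeleton). [folklore] -/
theorem integralMultipleTwoAdicWith_of_heightNormalFormMixed (a : ℕ)
    (hHNF : ∀ n k : ℕ, k ≤ Nat.log 2 n →
      ∀ Q : ArithCircuit (AlgebraicClosure ℚ) (Fin n × Fin n), Q.IsFanInTwo →
        Q.Computes (MvPolynomial.map (Int.castRingHom (AlgebraicClosure ℚ)) (jet n k)) →
        ∃ (d : ℕ) (β : Fin (d + 1) → AlgebraicClosure ℚ)
          (γ : Fin (d + 1) → Fin (d + 1) → Fin (d + 1) → ℤ)
          (Q' : ArithCircuit (AlgebraicClosure ℚ) (Fin n × Fin n)) (N h : ℕ)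
          (P : Fin (4 * Q'.size + 1) → Fin (d + 1) → ℤ),
          β 0 = 1 ∧ LinearIndependent ℚ β ∧
          (∀ a b, β a * β b = ∑ l, (γ a b l : AlgebraicClosure ℚ) * β l) ∧
          Q'.IsFanInTwo ∧
          Q'.Computes (MvPolynomial.map (Int.castRingHom (AlgebraicClosure ℚ)) (jet n k)) ∧
          1 ≤ N ∧ N ≤ 2 ^ h ∧
          (∀ v : Fin (4 * Q'.size + 1),
            (N : AlgebraicClosure ℚ) * slotConst Q' v = ∑ l, (P v l : AlgebraicClosure ℚ) * β l) ∧
          (∀ v l, (P v l).natAbs ≤ 2 ^ h) ∧ (∀ a b l, (γ a b l).natAbs ≤ 2 ^ h) ∧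
          d + 1 ≤ (Q.size + n + 2) ^ a ∧ h ≤ (Q.size + n + 2) ^ a ∧
          Q'.size ≤ (Q.size + n + 2) ^ a ∧
          (Odd N ∨ (skeleton Q').formalDegree ≤ (Q.size + n + 2) ^ a)) :
    IntegralMultipleTwoAdicWith (5 * a + 12) := by
  intro n k hk Q hQ2 hQc
  obtain ⟨d, β, γ, Q', N, h, P, hβ0, hind, hβ, hQ'2, hQ'c, hN1, hNh, hP, hPh, hγh, hd, hh, hs, hmix⟩ :=
    hHNF n k hk Q hQ2 hQc
  have hX : 2 ≤ Q.size + n + 2 := by omega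
  have hpow : (Q.size + n + 2) ^ (5 * a + 11) ≤ (Q.size + n + 2) ^ (5 * a + 12) :=
    Nat.pow_le_pow_right (by omega) (by omega)
  rcases hmix with hodd | hfd
  · obtain ⟨Pc, t, M, hM, hPc2, hPcc, hPch, hPcsize, hv⟩ :=
      integralMultipleTwoAdic_numberFieldOddSlice (jet n k) β hβ0 hind γ hβ Q' hQ'2 hQ'c N h hodd hNh
        P hP hPh hγh
    have henv := heightNormalForm_envelope_le (a := a) hX hd hs hh
    exact ⟨Pc, t, M, hM, hPc2, hPcc, hPch, (hPcsize.trans henv).trans hpow,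
      by rw [hv]; exact Nat.zero_le _⟩
  · obtain ⟨Pc, t, M, hM, hPc2, hPcc, hPch, hPcsize, hv⟩ :=
      integralMultipleTwoAdic_numberFieldFormalDegreeSlice (jet n k) β hβ0 hind γ hβ Q' hQ'2 hQ'c N
        h hN1 hNh P hP hPh hγh
    have henv := heightNormalFormFdeg_envelope_le (a := a) hX hd hs hh
    refine ⟨Pc, t, M, hM, hPc2, hPcc, hPch, hPcsize.trans henv, hv.trans ?_⟩
    calc (skeleton Q').formalDegree * h ≤ (Q.size + n + 2) ^ a * (Q.size + n + 2) ^ a :=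
          Nat.mul_le_mul hfd hh
      _ = (Q.size + n + 2) ^ (2 * a) := by rw [← pow_add]; ring_nf
      _ ≤ (Q.size + n + 2) ^ (5 * a + 12) := Nat.pow_le_pow_right (by omega) (by omega)

end Summit.ValiantsHypothesis.ValiantsHypothesis.Theorems.AnyonJets.JetConstantElim

end
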